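import Summits.ResolutionOfSingularities.ResolutionOfSingularities.Theorems.PAlterationPialtAtomsOpenRange
import Literature.AlgebraicGeometry.Resolution.ProperModelsPatchingOfResolution
import Literature.AlgebraicGeometry.Resolution.ProperModelsFunctionField
import Literature.AlgebraicGeometry.Resolution.ResolutionOfCurves
import HarnessLib

/-!
# Stub `stub_regModelAt_of_trdeg_le_one` (crux stmt-ResolutionOfSingularities-0552, line `Sketch` rev. c6)

Certification stub of the skeleton `Sketch` (rev. c6) for the crux `PalterationThesis`
(stmt-ResolutionOfSingularities-0552): the residue `RegModel_K` (every function field `F/K`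
essentially of finite type having a proper model has a REGULAR proper model — open in
transcendence degree `≥ 4`) is a THEOREM in transcendence degree `≤ 1`, over every field `K`,
unconditionally.

Proof. Take a proper model `M` of `F/K`. Its scheme `M.X` is integral and proper over `Spec K`
through `M.π`, and `dim M.X = trdeg_K F` — the proper-model twin of
`ProjModel.topologicalKrullDim_eq_of_trdeg`, already landed as
`Pialt.OpenRange.properModel_topologicalKrullDim_eq_of_trdeg`
(`Summits/ResolutionOfSingularities/ResolutionOfSingularities/Theorems/PAlterationPialtAtomsOpenRange.lean`:
Görtz–Wedhorn I, Thm. 5.22 (3) `dim X = trdeg_K K(X)`,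
`Literature.AlgebraicGeometry.Motives.height_top_eq_trdeg`, together with `K(M) ≅ F` over `K`,
`ProperModel.funFieldAlgEquiv`), reused here. So `dim M.X ≤ 1`, reduced curves over a field have
resolutions unconditionally (`hasResolution_of_dim_le_one`, `ResolutionOfCurves.lean`), and a
resolution of a proper model is a regular proper model dominating it
(`ProperModel.exists_hom_isRegular_of_hasResolution`).

## References

* U. Görtz, T. Wedhorn, *Algebraic Geometry I* (2nd ed., 2020), Thm. 5.22 (3). [GortzWedhorn2020]
* O. Zariski, P. Samuel, *Commutative Algebra* II, Ch. VI §17. [ZariskiSamuel1960]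
* R. Hartshorne, *Algebraic Geometry* (1977), Ch. V Rem. 3.8.1 (curves). [Hartshorne1977]
-/

set_option linter.dupNamespace false

noncomputable section

open CategoryTheory AlgebraicGeometry
open Literature.AlgebraicGeometry.Resolution
open Summit.ResolutionOfSingularities.ResolutionOfSingularities.Theorems.Pialt.OpenRange
  (properModel_topologicalKrullDim_eq_of_trdeg)

namespace Summit.ResolutionOfSingularities.ResolutionOfSingularities.Theorems.PalterationThesis.ZariskiPerfect

/-! ## The residue `RegModel_K` in transcendence degree `≤ 1` -/

/-- CERTIFICATION STUB (worker-sized): the residue `RegModel_K` is a THEOREM in transcendence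
degree `≤ 1` over every field — a proper model of a function field of transcendence degree `≤ 1`
is a curve (`properModel_topologicalKrullDim_eq_of_trdeg`), reduced curves over a field have
resolutions unconditionally (`hasResolution_of_dim_le_one`), and a resolution of a proper model
is a regular proper model dominating it (`ProperModel.exists_hom_isRegular_of_hasResolution`).
[folklore] -/
theorem stub_regModelAt_of_trdeg_le_one (K : Type) [Field K] (F : Type) [Field F] [Algebra K F]
    [Algebra.EssFiniteType K F] (d : ℕ) (hd : d ≤ 1) (htr : Algebra.trdeg K F = d)
    (hM : Nonempty (ProperModel K F)) : ∃ N : ProperModel K F, Scheme.IsRegular N.X := by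
  obtain ⟨M⟩ := hM
  -- `dim M.X = trdeg_K F = d ≤ 1`
  have hdim : topologicalKrullDim M.X ≤ 1 := by
    rw [properModel_topologicalKrullDim_eq_of_trdeg M htr]
    exact_mod_cast hd
  -- curves have resolutions; a resolution of a proper model is a regular proper model over it
  obtain ⟨N, -, hN⟩ := ProperModel.exists_hom_isRegular_of_hasResolution M
    (hasResolution_of_dim_le_one M.X M.π hdim)
  exact ⟨N, hN⟩

end Summit.ResolutionOfSingularities.ResolutionOfSingularities.Theorems.PalterationThesis.ZariskiPerfect

end
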